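import Mathlib
import Literature.Geometry.Lorentzian.CauchyDevelopment
import Literature.Geometry.Lorentzian.KerrConvergence
import Literature.Geometry.Lorentzian.KerrSchild
import Literature.Geometry.Lorentzian.CauchyDevelopmentGlobalHyperbolicityProofs
import Literature.Geometry.Lorentzian.CausalCurveLengthBound
import Literature.Geometry.Lorentzian.TimeCones
import Literature.Geometry.Lorentzian.BackgroundChartCalculusFramed
import Literature.Geometry.Lorentzian.BackgroundChartCalculusLocal
import Literature.Geometry.Lorentzian.KerrWaveEnergy
import Literature.Geometry.Lorentzian.KerrWaveDecay
import Literature.Geometry.Lorentzian.KerrHyperboloidalFlux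
import Literature.Geometry.Lorentzian.KerrNullFrameFlux
import HarnessLib

/-!
# Causal coordinate legs on a boosted Kerr–Schild background under `C⁰` metric control

Elementary Lorentzian-causality and Kerr–Schild bookkeeping for chart maps `Ψ : U → 𝓢` of a spacetime
`𝓢` on the domain `U` of a boosted, translated Kerr–Schild background `B = (Λ, c, M, a)`
(`boostedKerrBackground`), whose pulled-back metric is `C⁰`-close to the model
(`‖Ψ^* g − g_B‖ ≤ 1/(20‖Λ‖²)` in operator norm) at rest radius `r ≥ 100 M`:

* `kerrBilin_ofTimeSpace_one_le`, `val_mfderiv_lorentz_le`, `val_mfderiv_axis_le` — cone algebra: for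
  rest-frame directions `(1, η)` with `‖η‖ ≤ ½` the push-forwards `dΨ(Λ(1, η))` are uniformly timelike
  and pairwise in one timecone (O'Neill 1983, Ch. 5, Lemma 5.26 ff.; Visser arXiv:0706.0622, (32)–(35));
* `radius_smul_le`, `exists_collar_scale` — the Kerr–Schild radius along a spatial rest-frame ray:
  `r(λξ) ≤ λ r(ξ)` for `0 < λ ≤ 1`, and a collar scale `σ` with `r(σξ) = R₁ + ½` (Visser (35));
* `segment_mem_causalFuture`, `leg_two_causal` — a coordinate segment with causal velocities which is
  future-directed at its start is a future causal curve (one sign along a connected set), so it joins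
  its endpoints causally (O'Neill 1983, Ch. 14, p. 402);
* `leg_one` — the `Λe₀`-line of a chart below a point, when future-directed with
  `g(dΨ Λe₀, dΨ Λe₀) ≤ −9/10`, is a future causal curve of arc length `≥ (9/10) × (parameter length)`
  (O'Neill 1983, Ch. 5, Def. 5.11);
* `subwall_ineq`, `wall_le_tenth`, `leg_two_kinematics` — bookkeeping of a rest-speed-`½` coordinate
  segment from the collar sphere `{r = R₁ + ½}` out to a point under a non-decreasing, sublinear lab-time
  wall `W` of slope `≤ 1/(10‖Λ‖²)`: it stays in the domain, under the wall, with rest radii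
  `≥ R₁ + ½`;
* `exists_arcLength_le_of_mem_causalPast_inter_causalFuture` — in a Cauchy development the future causal
  curves inside `J⁻(q) ∩ J⁺(ιX)` have uniformly bounded length (compactness, Hawking–Ellis 1973,
  Prop. 6.6.6, plus strong causality, O'Neill 1983, Lemma 14.14; packaged from
  `IsStronglyCausal.exists_arcLength_le_of_isCompact`).

These are the legs of the "no late escape" argument of the crux `StarvedNecks.NeckGapDecay`
(route StarvedNecks of `FinalStateConjecture`, stub S4b). Everything is proved; no definitions and no
named facts are introduced.

## References

* B. O'Neill, *Semi-Riemannian geometry with applications to relativity*, Academic Press 1983, Ch. 5,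
  Lemma 5.26, Lemma 5.29, Def. 5.11; Ch. 14, pp. 402–403, Cor. 14.1, Lemma 14.14. Key
  `ONeillSemiRiemannian1983`.
* S. W. Hawking, G. F. R. Ellis, *The large scale structure of space-time*, CUP 1973, §6.6, Prop. 6.6.6.
* J. K. Beem, P. E. Ehrlich, *Global Lorentzian Geometry*, Marcel Dekker 1981, Lemma 3.5.
* M. Visser, *The Kerr spacetime: a brief introduction*, arXiv:0706.0622, (32)–(35). Key `arXiv07060622`.
-/

noncomputable section

open scoped Manifold ContDiff Topology ENNReal
open Filter Set MeasureTheory Topology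

namespace Literature.Geometry.Lorentzian.BoostedKerrLegs

-- instance search through nested operator types `E4 →L[ℝ] E4 →L[ℝ] ℝ`
set_option maxSynthPendingDepth 3

/-! ## (A) Uniform length bound in `J⁻(q) ∩ J⁺(ιX)` -/

section Causal

variable {X : Type} [TopologicalSpace X] [ChartedSpace E3 X] [IsManifold (𝓡 3) ∞ X] [ConnectedSpace X]
  {D : InitialDataSet (𝓡 3) X}

/-- **(A) Future causal curves in `J⁻(q) ∩ J⁺(ιX)` have uniformly bounded length.** For a Cauchy
development `𝒟` (so `ιX` is a Cauchy hypersurface) and any point `q`, the set `J⁻(q) ∩ J⁺(ιX)` is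
compact (Hawking–Ellis 1973, Prop. 6.6.6; O'Neill 1983, Lemma 14.40) and `𝒟` is strongly causal
(O'Neill 1983, Thm. 14.38), hence there is `L < ∞` bounding the arc length of every future causal
curve segment contained in it (Beem–Ehrlich 1981, proof of Lemma 3.5; O'Neill 1983, Lemma 14.14).
[folklore] -/
theorem exists_arcLength_le_of_mem_causalPast_inter_causalFuture (𝒟 : CauchyDevelopment D)
    (q : 𝒟.carrier) :
    ∃ L : ℝ≥0∞, L < ⊤ ∧ ∀ (γ : ℝ → 𝒟.carrier) (a b : ℝ), a ≤ b →
      𝒟.metric.IsFutureCausalCurveOn 𝒟.timeOrientation γ (Icc a b) →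
      (∀ s ∈ Icc a b, γ s ∈ 𝒟.metric.causalPast 𝒟.timeOrientation {q} ∩
        𝒟.metric.causalFuture 𝒟.timeOrientation (range 𝒟.embed)) →
      𝒟.metric.arcLength γ a b ≤ L :=
  LorentzianMetric.IsStronglyCausal.exists_arcLength_le_of_isCompact 𝒟.timeOrientation
    (by exact_mod_cast le_top) 𝒟.isStronglyCausal
    (𝒟.isCompact_causalPast_inter_causalFuture_range q)

end Causal

/-! ## Real analysis: a sublinear monotone wall lies below a tenth of the rest time -/

/-- **Wall below a tenth of the rest time.** For a non-decreasing `W` with `W(s)/s → 0`, `A > 0`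
and `C₀`, there is `C` such that whenever `0 ≤ T` and `s ≤ A (T + 2 W s) + C₀` (the lab time `s`
of an escape point is controlled by its rest time `T` and twice its rest radius `≤ W s`), then
`W s ≤ T/10 + C`. [folklore] -/
theorem wall_le_tenth {W : ℝ → ℝ} (hWm : Monotone W) (hWs : Tendsto (fun s ↦ W s / s) atTop (𝓝 0))
    {A : ℝ} (hA : 0 < A) (C₀ : ℝ) :
    ∃ C : ℝ, ∀ T s : ℝ, 0 ≤ T → s ≤ A * (T + 2 * W s) + C₀ → W s ≤ T / 10 + C := by
  have hε : (0 : ℝ) < 1 / (40 * A) := by positivity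
  obtain ⟨S₀, hS₀⟩ := eventually_atTop.1 ((Metric.tendsto_nhds.1 hWs) _ hε)
  set S₁ : ℝ := max S₀ 1 with hS₁
  refine ⟨max (W S₁) 0 + |C₀| / A, fun T s hT hs ↦ ?_⟩
  have hC : 0 ≤ |C₀| / A := by positivity
  rcases le_or_gt s S₁ with h | h
  · have h1 : W s ≤ W S₁ := hWm h
    have h2 : W S₁ ≤ max (W S₁) 0 := le_max_left _ _
    have h3 : 0 ≤ T / 10 := by positivity
    linarith
  · have hs0 : 0 < s := lt_of_lt_of_le' h (le_trans zero_le_one (le_max_right _ _))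
    have h1 := hS₀ s (le_trans (le_max_left _ _) h.le)
    rw [Real.dist_eq, sub_zero, abs_lt, div_lt_iff₀ hs0] at h1
    have h2 : W s < 1 / (40 * A) * (A * (T + 2 * W s) + C₀) :=
      h1.2.trans_le (mul_le_mul_of_nonneg_left hs hε.le)
    have h3 : 1 / (40 * A) * (A * (T + 2 * W s) + C₀) = T / 40 + W s / 20 + C₀ / A / 40 := by
      field_simp
      ring
    rw [h3] at h2
    have h4 : C₀ / A ≤ |C₀| / A := div_le_div_of_nonneg_right (le_abs_self C₀) hA.le
    have h5 : 0 ≤ max (W S₁) 0 := le_max_right _ _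
    nlinarith

/-! ## Coordinate bookkeeping in `E4` -/

/-- `(t + s, y) = (t, y) + s e₀`. [folklore] -/
private theorem ofTimeSpace_add (t s : ℝ) (y : E3) :
    E4.ofTimeSpace (t + s) y = E4.ofTimeSpace t y + s • E4.basisVector 0 := by
  ext i
  refine Fin.cases ?_ (fun j ↦ ?_) i
  · simp
  · simp [Fin.succ_ne_zero]

/-- The affine rest-frame parametrisation of leg 2:
`(t₀ + θ, (σ + κθ) ξ) = (t₀, σ ξ) + θ (1, κ ξ)`. [folklore] -/
private theorem ofTimeSpace_affine (t₀ σ κ θ : ℝ) (ξ : E3) :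
    E4.ofTimeSpace (t₀ + θ) ((σ + κ * θ) • ξ) =
      E4.ofTimeSpace t₀ (σ • ξ) + θ • E4.ofTimeSpace 1 (κ • ξ) := by
  ext i
  refine Fin.cases ?_ (fun j ↦ ?_) i
  · simp
  · simp only [E4.ofTimeSpace_apply_succ, PiLp.add_apply, PiLp.smul_apply, smul_eq_mul]
    ring

/-- `(1, 0) = e₀`. [folklore] -/
theorem ofTimeSpace_one_zero : E4.ofTimeSpace 1 (0 : E3) = E4.basisVector 0 := by
  ext i
  refine Fin.cases ?_ (fun j ↦ ?_) i
  · simp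
  · simp [Fin.succ_ne_zero]

/-- `‖(t, y)‖ ≤ |t| + ‖y‖`. [folklore] -/
theorem norm_ofTimeSpace_le (t : ℝ) (y : E3) : ‖E4.ofTimeSpace t y‖ ≤ |t| + ‖y‖ := by
  have h : E4.ofTimeSpace t y = t • E4.basisVector 0 + E4.ofTimeSpace 0 y := by
    rw [add_comm, ← ofTimeSpace_add, zero_add]
  have h0 : ‖E4.ofTimeSpace 0 y‖ = ‖y‖ := by
    rw [EuclideanSpace.norm_eq, EuclideanSpace.norm_eq, Fin.sum_univ_succ]
    simp
  have h1 : ‖(E4.basisVector 0 : E4)‖ = 1 := by simp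
  calc ‖E4.ofTimeSpace t y‖ ≤ ‖t • (E4.basisVector 0 : E4)‖ + ‖E4.ofTimeSpace 0 y‖ := by
        rw [h]; exact norm_add_le _ _
    _ = |t| + ‖y‖ := by rw [norm_smul, h1, mul_one, Real.norm_eq_abs, h0]

/-- `‖(1, y)‖ ≤ 1 + ‖y‖`. [folklore] -/
private theorem norm_ofTimeSpace_one_le (y : E3) : ‖E4.ofTimeSpace 1 y‖ ≤ 1 + ‖y‖ := by
  simpa using norm_ofTimeSpace_le 1 y

/-- The rest frame of a lab point: `Λ⁻¹((Λ z + c) − c) = z`. [folklore] -/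
private theorem poincareInv_apply_add (Λ : lorentzGroup) (c z : E4) :
    poincareInv Λ c ((Λ : E4 ≃L[ℝ] E4) z + c) = z := by
  simp only [poincareInv, add_sub_cancel_right, ContinuousLinearEquiv.symm_apply_apply]

/-- A lab point from its rest frame: `Λ (Λ⁻¹(x − c)) + c = x`. [folklore] -/
theorem apply_poincareInv_add (Λ : lorentzGroup) (c x : E4) :
    (Λ : E4 ≃L[ℝ] E4) (poincareInv Λ c x) + c = x := by
  simp only [poincareInv, ContinuousLinearEquiv.apply_symm_apply, sub_add_cancel]

/-- `‖Λ‖ ≥ 1` for a Lorentz transformation: `η(Λe₀, Λe₀) = −1` forces `|(Λe₀)⁰| ≥ 1`. [folklore] -/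
theorem one_le_norm_lorentz (Λ : lorentzGroup) : 1 ≤ ‖((Λ : E4 ≃L[ℝ] E4) : E4 →L[ℝ] E4)‖ := by
  have hη : Minkowski.bilin ((Λ : E4 ≃L[ℝ] E4) (E4.basisVector 0))
      ((Λ : E4 ≃L[ℝ] E4) (E4.basisVector 0)) = -1 := by
    rw [Λ.2 (E4.basisVector 0) (E4.basisVector 0)]
    exact Minkowski.bilin_basisVector_zero
  set v : E4 := (Λ : E4 ≃L[ℝ] E4) (E4.basisVector 0) with hv
  have h1 : 1 ≤ (v 0) ^ 2 := by
    rw [Minkowski.bilin_apply] at hη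
    have : 0 ≤ ∑ i : Fin 3, v i.succ * v i.succ := Finset.sum_nonneg fun i _ ↦ mul_self_nonneg _
    nlinarith
  have h2 : 1 ≤ |v 0| := (one_le_sq_iff_one_le_abs _).1 h1
  have h3 : |v 0| ≤ ‖v‖ := by
    have := PiLp.norm_apply_le v 0
    rwa [Real.norm_eq_abs] at this
  have h4 : ‖v‖ ≤ ‖((Λ : E4 ≃L[ℝ] E4) : E4 →L[ℝ] E4)‖ := by
    have h := ((Λ : E4 ≃L[ℝ] E4) : E4 →L[ℝ] E4).le_opNorm (E4.basisVector 0)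
    have h1 : ‖(E4.basisVector 0 : E4)‖ = 1 := by simp
    rw [h1, mul_one] at h
    exact h
  linarith

/-- `(t, y)¹ = y⁰`. [folklore] -/
private theorem ofTimeSpace_apply_one (t : ℝ) (y : E3) : E4.ofTimeSpace t y 1 = y 0 :=
  E4.ofTimeSpace_apply_succ t y 0

/-- `(t, y)² = y¹`. [folklore] -/
private theorem ofTimeSpace_apply_two (t : ℝ) (y : E3) : E4.ofTimeSpace t y 2 = y 1 :=
  E4.ofTimeSpace_apply_succ t y 1

/-- `(t, y)³ = y²`. [folklore] -/
private theorem ofTimeSpace_apply_three (t : ℝ) (y : E3) : E4.ofTimeSpace t y 3 = y 2 :=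
  E4.ofTimeSpace_apply_succ t y 2

/-! ## The label's time axis: ride kinematics on a boosted Kerr background -/

section Axis

variable (Λ : lorentzGroup) (c : E4) (M a : ℝ)

/-- The inverse Poincaré map is affine: `Λ⁻¹(x + uΛe₀ − c) = Λ⁻¹(x − c) + u e₀`. [folklore] -/
private theorem poincareInv_add_smul (p : E4) (u : ℝ) :
    poincareInv Λ c (p + u • (Λ : E4 ≃L[ℝ] E4) (E4.basisVector 0)) =
      poincareInv Λ c p + u • E4.basisVector 0 := by
  -- adapted from `poincareInv_add_smul` (Theorems/StarvedNecksSeamedChartsExhaustRide)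
  simp only [poincareInv]
  have : p + u • (Λ : E4 ≃L[ℝ] E4) (E4.basisVector 0) - c =
      (p - c) + u • (Λ : E4 ≃L[ℝ] E4) (E4.basisVector 0) := by abel
  rw [this, map_add, map_smul, ContinuousLinearEquiv.symm_apply_apply]

/-- Chart time grows linearly along the label's time axis: `t(y + s Λe₀) = t(y) + s`. [folklore] -/
private theorem time_add_smul_axis (y : E4) (s : ℝ) :
    (boostedKerrBackground Λ c M a).time (y + s • (Λ : E4 ≃L[ℝ] E4) (E4.basisVector 0)) =
      (boostedKerrBackground Λ c M a).time y + s := by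
  -- adapted from the S2 work file (stub_orientationAnchor)
  show poincareInv Λ c _ 0 = poincareInv Λ c y 0 + s
  rw [poincareInv_add_smul]
  simp [E4.basisVector]

/-- The rest-frame radius is constant along the label's time axis: `r(y + s Λe₀) = r(y)`. [folklore] -/
private theorem radius_add_smul_axis (y : E4) (s : ℝ) :
    (boostedKerrBackground Λ c M a).radius (y + s • (Λ : E4 ≃L[ℝ] E4) (E4.basisVector 0)) =
      (boostedKerrBackground Λ c M a).radius y := by
  show Kerr.radius a (poincareInv Λ c _) = Kerr.radius a (poincareInv Λ c y)
  rw [poincareInv_add_smul, Kerr.radius_add_time_smul_basisVector]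

/-- The boosted Kerr domain is invariant along the label's time axis. [folklore] -/
private theorem mem_domain_add_smul_axis {y : E4} (hy : y ∈ (boostedKerrBackground Λ c M a).domain)
    (s : ℝ) :
    y + s • (Λ : E4 ≃L[ℝ] E4) (E4.basisVector 0) ∈ (boostedKerrBackground Λ c M a).domain := by
  have hy' : max (Kerr.rPlus M a) 0 < Kerr.radius a (poincareInv Λ c y) := hy
  show max (Kerr.rPlus M a) 0 < Kerr.radius a (poincareInv Λ c _)
  rwa [poincareInv_add_smul, Kerr.radius_add_time_smul_basisVector]

end Axis

/-! ## Kerr–Schild algebra: radius scaling along rays and a cone bound -/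

/-- **Scaling of the Kerr–Schild radius along a spatial ray**: `r(λξ) ≤ λ r(ξ)` for `0 < λ ≤ 1`
(the radius of `ξ` computed with the larger spin `a/λ` is smaller: evaluate the defining quartic of
`λξ` at `λ r(ξ)`, where it equals `λ²(1 − λ²)a²(r² − z²) ≥ 0` since `z² ≤ r²`). Visser
arXiv:0706.0622, (35). [folklore] -/
theorem radius_smul_le (a : ℝ) (ξ : E3) {lam : ℝ} (h0 : 0 < lam) (h1 : lam ≤ 1)
    (hr : 0 < Kerr.radius a (E4.ofTimeSpace 0 ξ)) :
    Kerr.radius a (E4.ofTimeSpace 0 (lam • ξ)) ≤ lam * Kerr.radius a (E4.ofTimeSpace 0 ξ) := by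
  have hy3 : E4.ofTimeSpace 0 ξ 3 = ξ 2 := ofTimeSpace_apply_three 0 ξ
  have hyl3 : E4.ofTimeSpace 0 (lam • ξ) 3 = lam * ξ 2 := by
    rw [ofTimeSpace_apply_three]; simp
  have hN : E4.spatialNorm (E4.ofTimeSpace 0 ξ) = ‖ξ‖ := E4.spatialNorm_ofTimeSpace 0 ξ
  have hNl : E4.spatialNorm (E4.ofTimeSpace 0 (lam • ξ)) = lam * ‖ξ‖ := by
    rw [E4.spatialNorm_ofTimeSpace, norm_smul, Real.norm_eq_abs, abs_of_pos h0]
  have hq1 := Kerr.radius_quartic a (E4.ofTimeSpace 0 ξ)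
  have hq2 := Kerr.radius_quartic a (E4.ofTimeSpace 0 (lam • ξ))
  have hz := Kerr.sq_apply_three_le_sq (a := a) hr
  have hs := Kerr.spatialNorm_sq_sub_sq_le_radius_sq a (E4.ofTimeSpace 0 (lam • ξ))
  rw [hN, hy3] at hq1
  rw [hNl, hyl3] at hq2
  rw [hy3] at hz
  rw [hNl] at hs
  have hq0 : 0 ≤ Kerr.radius a (E4.ofTimeSpace 0 (lam • ξ)) := Kerr.radius_nonneg a _
  set r := Kerr.radius a (E4.ofTimeSpace 0 ξ) with hrdef
  set q := Kerr.radius a (E4.ofTimeSpace 0 (lam • ξ)) with hqdef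
  have hF : 0 < lam ^ 2 * r ^ 2 + q ^ 2 - ((lam * ‖ξ‖) ^ 2 - a ^ 2) := by
    have : 0 < lam ^ 2 * r ^ 2 := by positivity
    linarith
  have hid : (lam ^ 2 * r ^ 2 - q ^ 2) * (lam ^ 2 * r ^ 2 + q ^ 2 - ((lam * ‖ξ‖) ^ 2 - a ^ 2)) =
      lam ^ 2 * (1 - lam ^ 2) * a ^ 2 * (r ^ 2 - ξ 2 ^ 2) := by
    linear_combination lam ^ 4 * hq1 - hq2
  have hR : 0 ≤ lam ^ 2 * (1 - lam ^ 2) * a ^ 2 * (r ^ 2 - ξ 2 ^ 2) := by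
    have h1' : 0 ≤ 1 - lam ^ 2 := by nlinarith
    have h2' : 0 ≤ r ^ 2 - ξ 2 ^ 2 := by linarith
    positivity
  have hle : q ^ 2 ≤ (lam * r) ^ 2 := by
    by_contra hcon
    push Not at hcon
    have hneg : lam ^ 2 * r ^ 2 - q ^ 2 < 0 := by rw [mul_pow] at hcon; linarith
    nlinarith
  exact (pow_le_pow_iff_left₀ hq0 (by positivity) two_ne_zero).1 hle

/-- **Kerr–Schild cone bound at large radius.** At a point with `r > 0` and `H ≤ 1/100`
(e.g. `r ≥ 100 M`), for rest-frame vectors `(1, η₁)`, `(1, η₂)` of spatial norm `≤ ½`: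
`g_{M,a}((1,η₁), (1,η₂)) = −1 + η₁·η₂ + 2H(1 + ℓ⃗·η₁)(1 + ℓ⃗·η₂) ≤ −1 + ‖η₁‖‖η₂‖ + 1/20`
(`|ℓ⃗| = 1`, Cauchy–Schwarz). O'Neill 1983, Ch. 5, Lemma 5.26; Visser arXiv:0706.0622,
(32)–(35). [folklore] -/
theorem kerrBilin_ofTimeSpace_one_le {M a : ℝ} (hM : 0 ≤ M) {x : E4} (hx : 0 < Kerr.radius a x)
    (hH : Kerr.scalarH M a x ≤ 1 / 100) (η₁ η₂ : E3) (h₁ : ‖η₁‖ ≤ 1 / 2) (h₂ : ‖η₂‖ ≤ 1 / 2) :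
    Kerr.bilin M a x (E4.ofTimeSpace 1 η₁) (E4.ofTimeSpace 1 η₂) ≤ -1 + ‖η₁‖ * ‖η₂‖ + 1 / 20 := by
  have hH0 := Kerr.scalarH_nonneg hM a x
  have hl := Kerr.sum_sq_nullCovectorFun hx
  have h0 : Kerr.nullCovectorFun a x 0 = 1 := by simp [Kerr.nullCovectorFun]
  have hcov : ∀ η : E3, Kerr.nullCovector a x (E4.ofTimeSpace 1 η) = 1 + (Kerr.nullCovectorFun a x 1 * η 0 +
      Kerr.nullCovectorFun a x 2 * η 1 + Kerr.nullCovectorFun a x 3 * η 2) := by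
    intro η
    simp only [Kerr.nullCovector, E4.covector_apply, Fin.sum_univ_four, h0, E4.ofTimeSpace_apply_zero,
      ofTimeSpace_apply_one, ofTimeSpace_apply_two, ofTimeSpace_apply_three]
    ring
  have hmink : Minkowski.bilin (E4.ofTimeSpace 1 η₁) (E4.ofTimeSpace 1 η₂) =
      -1 + (η₁ 0 * η₂ 0 + η₁ 1 * η₂ 1 + η₁ 2 * η₂ 2) := by
    simp only [Minkowski.bilin_apply, Fin.sum_univ_three, E4.ofTimeSpace_apply_zero,
      E4.ofTimeSpace_apply_succ]
    ring
  rw [Kerr.bilin_apply, hmink, hcov, hcov]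
  generalize Kerr.nullCovectorFun a x 1 = l₁ at hl ⊢
  generalize Kerr.nullCovectorFun a x 2 = l₂ at hl ⊢
  generalize Kerr.nullCovectorFun a x 3 = l₃ at hl ⊢
  generalize Kerr.scalarH M a x = H at hH hH0 ⊢
  have hn1 := E3.norm_sq η₁
  have hn2 := E3.norm_sq η₂
  have hη₁ := norm_nonneg η₁
  have hη₂ := norm_nonneg η₂
  -- Cauchy–Schwarz, three times
  have hS : η₁ 0 * η₂ 0 + η₁ 1 * η₂ 1 + η₁ 2 * η₂ 2 ≤ ‖η₁‖ * ‖η₂‖ := by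
    have hsq : (η₁ 0 * η₂ 0 + η₁ 1 * η₂ 1 + η₁ 2 * η₂ 2) ^ 2 ≤ (‖η₁‖ * ‖η₂‖) ^ 2 := by
      rw [mul_pow, hn1, hn2]
      nlinarith [sq_nonneg (η₁ 0 * η₂ 1 - η₁ 1 * η₂ 0), sq_nonneg (η₁ 0 * η₂ 2 - η₁ 2 * η₂ 0),
        sq_nonneg (η₁ 1 * η₂ 2 - η₁ 2 * η₂ 1)]
    exact (abs_le_of_sq_le_sq' hsq (by positivity)).2
  have hm : ∀ η : E3, ‖η‖ ≤ 1 / 2 → |l₁ * η 0 + l₂ * η 1 + l₃ * η 2| ≤ 1 / 2 := by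
    intro η hη
    have hn := E3.norm_sq η
    have hsq : (l₁ * η 0 + l₂ * η 1 + l₃ * η 2) ^ 2 ≤ (1 / 2) ^ 2 := by
      have h4 : ‖η‖ ^ 2 ≤ (1 / 2) ^ 2 := pow_le_pow_left₀ (norm_nonneg η) hη 2
      nlinarith [sq_nonneg (l₁ * η 1 - l₂ * η 0), sq_nonneg (l₁ * η 2 - l₃ * η 0),
        sq_nonneg (l₂ * η 2 - l₃ * η 1)]
    exact abs_le.2 (abs_le_of_sq_le_sq' hsq (by norm_num))
  have hm₁ := abs_le.1 (hm η₁ h₁)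
  have hm₂ := abs_le.1 (hm η₂ h₂)
  generalize l₁ * η₁ 0 + l₂ * η₁ 1 + l₃ * η₁ 2 = m₁ at hm₁ ⊢
  generalize l₁ * η₂ 0 + l₂ * η₂ 1 + l₃ * η₂ 2 = m₂ at hm₂ ⊢
  have hP : (1 + m₁) * (1 + m₂) ≤ 9 / 4 := by nlinarith
  have hP0 : 0 ≤ (1 + m₁) * (1 + m₂) := by nlinarith
  have hHP : 2 * H * ((1 + m₁) * (1 + m₂)) ≤ 2 * (1 / 100) * (9 / 4) := by
    apply mul_le_mul _ hP hP0 (by norm_num)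
    linarith
  nlinarith

/-- The boosted Kerr–Schild form on boosted vectors is the Kerr–Schild form in the rest frame:
`g_B(x)(Λv, Λw) = g_{M,a}(Λ⁻¹(x − c))(v, w)`. Kerr–Schild 1965 (Lorentz covariance). [folklore] -/
private theorem boosted_bilin_apply (Λ : lorentzGroup) (c : E4) (M a : ℝ) (x v w : E4) :
    (boostedKerrBackground Λ c M a).bilin x ((Λ : E4 ≃L[ℝ] E4) v) ((Λ : E4 ≃L[ℝ] E4) w) =
      Kerr.bilin M a (poincareInv Λ c x) v w := by
  show boostedKerrBilin Λ c M a x _ _ = _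
  rw [boostedKerrBilin_apply, ContinuousLinearEquiv.symm_apply_apply,
    ContinuousLinearEquiv.symm_apply_apply]

/-! ## Chart-side calculus: metric values under small deviation, velocities of coordinate lines -/

section Chart

variable (𝓢 : Spacetime.{0} 4)

/-- **Metric value of pushed-forward vectors under a deviation bound**:
`g(dΨ v, dΨ w) ≤ g_B(v, w) + ‖Ψ^*g − g_B‖ ‖v‖ ‖w‖`. DHRT arXiv:2104.08222, §1. [folklore] -/
private theorem val_mfderiv_le_of_norm_deviation_le (B : ModelBackground) (Ψ : B.domain → 𝓢.carrier)
    (x : B.domain) {δ m : ℝ} (hdev : ‖𝓢.deviation B Ψ x‖ ≤ δ) (v w : E4) (hm : B.bilin x.1 v w ≤ m) :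
    𝓢.metric.val (Ψ x) (mfderiv 𝓘(ℝ, E4) (𝓡 4) Ψ x v) (mfderiv 𝓘(ℝ, E4) (𝓡 4) Ψ x w) ≤
      m + δ * ‖v‖ * ‖w‖ := by
  have happ := 𝓢.deviation_apply B Ψ x v w
  have h1 : 𝓢.deviation B Ψ x v w ≤ ‖𝓢.deviation B Ψ x‖ * ‖v‖ * ‖w‖ :=
    (Real.le_norm_self _).trans ((𝓢.deviation B Ψ x).le_opNorm₂ v w)
  have h2 : ‖𝓢.deviation B Ψ x‖ * ‖v‖ * ‖w‖ ≤ δ * ‖v‖ * ‖w‖ := by gcongr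
  linarith

/-- **Pointwise `C⁰` bound from a `C⁰` sup-norm bound**: if the `Cᵏ` sup norm of the extended
deviation over `val '' S` is `≤ δ`, then `‖(Ψ^*g − g_B)(x)‖ ≤ δ` at every `x ∈ S`.
Bartnik, CPAM 39 (1986), (1.3). [folklore] -/
theorem norm_deviation_le_of_supCkENorm_le (B : ModelBackground) (Ψ : B.domain → 𝓢.carrier)
    {S : Set B.domain} {k : ℕ} {δ : ℝ} (hδ : 0 ≤ δ)
    (h : supCkENorm (Subtype.val '' S) k (𝓢.deviationExtend B Ψ) ≤ ENNReal.ofReal δ)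
    (x : B.domain) (hx : x ∈ S) : ‖𝓢.deviation B Ψ x‖ ≤ δ := by
  -- adapted from `stub_pointwiseDeviation` (Theorems/StarvedNecksFutureOrientedOfSeamedStubPointwiseDeviation)
  have hmem : x.1 ∈ Subtype.val '' S := mem_image_of_mem _ hx
  have h1 := enorm_iteratedFDeriv_le_supCkENorm (Nat.zero_le k) hmem (𝓢.deviationExtend B Ψ)
  have h2 : ‖iteratedFDeriv ℝ 0 (𝓢.deviationExtend B Ψ) x.1‖ₑ ≤ ENNReal.ofReal δ := h1.trans h
  rw [← ofReal_norm, norm_iteratedFDeriv_zero, Spacetime.deviationExtend_coe,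
    ENNReal.ofReal_le_ofReal_iff hδ] at h2
  exact h2

/-- **Cone bound for a chart on a boosted Kerr background.** At a point of rest radius `≥ 100 M`
where `‖Ψ^*g − g_B‖ ≤ 1/(20‖Λ‖²)`, for rest-frame directions `(1, η₁)`, `(1, η₂)` with
`‖ηⱼ‖ ≤ ½`: `g(dΨ Λ(1,η₁), dΨ Λ(1,η₂)) ≤ −1 + ‖η₁‖‖η₂‖ + 1/20 + (1 + ‖η₁‖)(1 + ‖η₂‖)/20`.
O'Neill 1983, Ch. 5, Lemma 5.26; Visser arXiv:0706.0622, (32)–(35). [folklore] -/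
theorem val_mfderiv_lorentz_le (Λ : lorentzGroup) (c : E4) {M : ℝ} (a : ℝ) (hM : 0 ≤ M)
    (Ψ : (boostedKerrBackground Λ c M a).domain → 𝓢.carrier)
    (x : (boostedKerrBackground Λ c M a).domain)
    (hr : 100 * M ≤ (boostedKerrBackground Λ c M a).radius x.1)
    (hdev : ‖𝓢.deviation (boostedKerrBackground Λ c M a) Ψ x‖ ≤
      1 / (20 * ‖((Λ : E4 ≃L[ℝ] E4) : E4 →L[ℝ] E4)‖ ^ 2))
    (η₁ η₂ : E3) (h₁ : ‖η₁‖ ≤ 1 / 2) (h₂ : ‖η₂‖ ≤ 1 / 2) :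
    𝓢.metric.val (Ψ x)
      (mfderiv 𝓘(ℝ, E4) (𝓡 4) Ψ x ((Λ : E4 ≃L[ℝ] E4) (E4.ofTimeSpace 1 η₁)))
      (mfderiv 𝓘(ℝ, E4) (𝓡 4) Ψ x ((Λ : E4 ≃L[ℝ] E4) (E4.ofTimeSpace 1 η₂))) ≤
      -1 + ‖η₁‖ * ‖η₂‖ + 1 / 20 + (1 + ‖η₁‖) * (1 + ‖η₂‖) / 20 := by
  set K := ‖((Λ : E4 ≃L[ℝ] E4) : E4 →L[ℝ] E4)‖ with hK
  have hK1 : 1 ≤ K := one_le_norm_lorentz Λ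
  have hx' : 0 < Kerr.radius a (poincareInv Λ c x.1) := Kerr.radius_pos_of_mem_region x.2
  have hH : Kerr.scalarH M a (poincareInv Λ c x.1) ≤ 1 / 100 := by
    have h1 := Kerr.scalarH_le_div hM a hx'
    have hr' : 100 * M ≤ Kerr.radius a (poincareInv Λ c x.1) := hr
    calc Kerr.scalarH M a (poincareInv Λ c x.1) ≤ M / Kerr.radius a (poincareInv Λ c x.1) := h1
      _ ≤ 1 / 100 := by
          rw [div_le_div_iff₀ hx' (by norm_num : (0 : ℝ) < 100)]
          linarith
  have hmodel : (boostedKerrBackground Λ c M a).bilin x.1 ((Λ : E4 ≃L[ℝ] E4) (E4.ofTimeSpace 1 η₁))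
      ((Λ : E4 ≃L[ℝ] E4) (E4.ofTimeSpace 1 η₂)) ≤ -1 + ‖η₁‖ * ‖η₂‖ + 1 / 20 := by
    rw [boosted_bilin_apply]
    exact kerrBilin_ofTimeSpace_one_le hM hx' hH η₁ η₂ h₁ h₂
  have hv : ∀ η : E3, ‖(Λ : E4 ≃L[ℝ] E4) (E4.ofTimeSpace 1 η)‖ ≤ K * (1 + ‖η‖) := fun η ↦
    (((Λ : E4 ≃L[ℝ] E4) : E4 →L[ℝ] E4).le_opNorm (E4.ofTimeSpace 1 η)).trans
      (mul_le_mul_of_nonneg_left (norm_ofTimeSpace_one_le η) (norm_nonneg _))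
  have h := val_mfderiv_le_of_norm_deviation_le 𝓢 (boostedKerrBackground Λ c M a) Ψ x hdev _ _ hmodel
  have hη₁ := norm_nonneg η₁
  have hη₂ := norm_nonneg η₂
  have hprod : ‖(Λ : E4 ≃L[ℝ] E4) (E4.ofTimeSpace 1 η₁)‖ * ‖(Λ : E4 ≃L[ℝ] E4) (E4.ofTimeSpace 1 η₂)‖ ≤
      (K * (1 + ‖η₁‖)) * (K * (1 + ‖η₂‖)) :=
    mul_le_mul (hv η₁) (hv η₂) (norm_nonneg _) (by positivity)
  have hδ : 0 ≤ 1 / (20 * K ^ 2) := by positivity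
  have hfin : 1 / (20 * K ^ 2) * ‖(Λ : E4 ≃L[ℝ] E4) (E4.ofTimeSpace 1 η₁)‖ *
      ‖(Λ : E4 ≃L[ℝ] E4) (E4.ofTimeSpace 1 η₂)‖ ≤ (1 + ‖η₁‖) * (1 + ‖η₂‖) / 20 := by
    calc 1 / (20 * K ^ 2) * ‖(Λ : E4 ≃L[ℝ] E4) (E4.ofTimeSpace 1 η₁)‖ *
        ‖(Λ : E4 ≃L[ℝ] E4) (E4.ofTimeSpace 1 η₂)‖
        ≤ 1 / (20 * K ^ 2) * ((K * (1 + ‖η₁‖)) * (K * (1 + ‖η₂‖))) := by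
          rw [mul_assoc]; exact mul_le_mul_of_nonneg_left hprod hδ
      _ = (1 + ‖η₁‖) * (1 + ‖η₂‖) / 20 := by
          field_simp
  linarith

/-- **Cone bound for the label axis**: under the hypotheses of `val_mfderiv_lorentz_le`,
`g(dΨ Λe₀, dΨ Λe₀) ≤ −9/10`. O'Neill 1983, Ch. 5, Lemma 5.26. [folklore] -/
theorem val_mfderiv_axis_le (Λ : lorentzGroup) (c : E4) {M : ℝ} (a : ℝ) (hM : 0 ≤ M)
    (Ψ : (boostedKerrBackground Λ c M a).domain → 𝓢.carrier)
    (x : (boostedKerrBackground Λ c M a).domain)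
    (hr : 100 * M ≤ (boostedKerrBackground Λ c M a).radius x.1)
    (hdev : ‖𝓢.deviation (boostedKerrBackground Λ c M a) Ψ x‖ ≤
      1 / (20 * ‖((Λ : E4 ≃L[ℝ] E4) : E4 →L[ℝ] E4)‖ ^ 2)) :
    𝓢.metric.val (Ψ x)
      (mfderiv 𝓘(ℝ, E4) (𝓡 4) Ψ x ((Λ : E4 ≃L[ℝ] E4) (E4.basisVector 0)))
      (mfderiv 𝓘(ℝ, E4) (𝓡 4) Ψ x ((Λ : E4 ≃L[ℝ] E4) (E4.basisVector 0))) ≤ -(9 / 10) := by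
  have h := val_mfderiv_lorentz_le 𝓢 Λ c a hM Ψ x hr hdev 0 0 (by simp) (by simp)
  rw [ofTimeSpace_one_zero, norm_zero] at h
  linarith

/-- **Velocity of the chart image of an affine coordinate line**: for `ψ : E4 → 𝓢` differentiable
at `x₀ + σu`, the curve `s ↦ ψ(x₀ + su)` is differentiable at `σ` with velocity `dψ_{x₀+σu}(u)`.
[folklore] -/
private theorem velocity_comp_affine (ψ : E4 → 𝓢.carrier) (x₀ u : E4) (σ : ℝ)
    (hψ : MDifferentiableAt 𝓘(ℝ, E4) (𝓡 4) ψ (x₀ + σ • u)) :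
    MDifferentiableAt 𝓘(ℝ, ℝ) (𝓡 4) (fun s : ℝ ↦ ψ (x₀ + s • u)) σ ∧
      velocity (𝓡 4) (fun s : ℝ ↦ ψ (x₀ + s • u)) σ = mfderiv 𝓘(ℝ, E4) (𝓡 4) ψ (x₀ + σ • u) u := by
  set p : ℝ → E4 := fun s ↦ x₀ + s • u with hp
  have hpd : HasDerivAt p u σ := by
    have h := ((hasDerivAt_id σ).smul_const u).const_add x₀
    rw [one_smul] at h
    exact h
  have hpf : HasFDerivAt p ((1 : ℝ →L[ℝ] ℝ).smulRight u) σ := hasDerivAt_iff_hasFDerivAt.1 hpd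
  have hpm : HasMFDerivAt 𝓘(ℝ, ℝ) 𝓘(ℝ, E4) p σ ((1 : ℝ →L[ℝ] ℝ).smulRight u) :=
    (hasMFDerivAt_iff_hasFDerivAt (𝕜 := ℝ) (E := ℝ) (E' := E4) (f := p) (x := σ)).2 hpf
  have hcomp := hψ.hasMFDerivAt.comp σ hpm
  refine ⟨hcomp.mdifferentiableAt, ?_⟩
  unfold velocity
  rw [show (fun s : ℝ ↦ ψ (x₀ + s • u)) = ψ ∘ p from rfl, hcomp.mfderiv]
  change (mfderiv 𝓘(ℝ, E4) (𝓡 4) ψ (x₀ + σ • u)) (((1 : ℝ →L[ℝ] ℝ) (1 : ℝ)) • u) = _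
  rw [one_apply_eq_self, one_smul]

/-- The inverse chart of an open submanifold of `E4` is the corestriction on the domain:
`(chartAt E4 x₁).symm y = ⟨y, hy⟩`. [folklore] -/
private theorem chartAt_symm_eq (B : ModelBackground) (x₁ : B.domain) {y : E4}
    (hy : y ∈ (B.domain : Set E4)) : (chartAt E4 x₁).symm y = ⟨y, hy⟩ :=
  Subtype.ext (OpensChart.chartAt_symm_val x₁ hy)

/-- Transfer of causality between the parametrisation `Ψ ∘ (chartAt E4 x₁).symm` at `y` and the
chart map `Ψ` at `⟨y, hy⟩` (same vector, base points `Ψ((chartAt E4 x₁).symm y) = Ψ⟨y, hy⟩`). [folklore] -/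
private theorem isCausal_comp_chartAt_symm_iff (B : ModelBackground) (Ψ : B.domain → 𝓢.carrier)
    (x₁ : B.domain) {y : E4} (hy : y ∈ (B.domain : Set E4))
    (hΨ : MDifferentiableAt 𝓘(ℝ, E4) (𝓡 4) Ψ ⟨y, hy⟩) (v : E4) :
    𝓢.metric.IsCausal (mfderiv 𝓘(ℝ, E4) (𝓡 4) (Ψ ∘ (chartAt E4 x₁).symm) y v) ↔
      𝓢.metric.IsCausal (mfderiv 𝓘(ℝ, E4) (𝓡 4) Ψ ⟨y, hy⟩ v) := by
  -- adapted from `stub_oneSign` (Theorems/StarvedNecksFutureOrientedOfSeamedStubOneSign)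
  have hp : (chartAt E4 x₁).symm y = ⟨y, hy⟩ := chartAt_symm_eq B x₁ hy
  rw [𝓢.mfderiv_comp_chartAt_symm_apply B Ψ x₁ hy hΨ v]
  show 𝓢.metric.IsCausal (x := Ψ ((chartAt E4 x₁).symm y)) _ ↔ _
  rw [hp]

/-- Transfer of future-directedness between the parametrisation `Ψ ∘ (chartAt E4 x₁).symm` at
`y` and the chart map `Ψ` at `⟨y, hy⟩`. [folklore] -/
private theorem isFutureDirected_comp_chartAt_symm_iff (B : ModelBackground) (Ψ : B.domain → 𝓢.carrier)
    (x₁ : B.domain) {y : E4} (hy : y ∈ (B.domain : Set E4))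
    (hΨ : MDifferentiableAt 𝓘(ℝ, E4) (𝓡 4) Ψ ⟨y, hy⟩) (v : E4) :
    𝓢.timeOrientation.IsFutureDirected (mfderiv 𝓘(ℝ, E4) (𝓡 4) (Ψ ∘ (chartAt E4 x₁).symm) y v) ↔
      𝓢.timeOrientation.IsFutureDirected (mfderiv 𝓘(ℝ, E4) (𝓡 4) Ψ ⟨y, hy⟩ v) := by
  -- adapted from `stub_oneSign` (Theorems/StarvedNecksFutureOrientedOfSeamedStubOneSign)
  have hp : (chartAt E4 x₁).symm y = ⟨y, hy⟩ := chartAt_symm_eq B x₁ hy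
  rw [𝓢.mfderiv_comp_chartAt_symm_apply B Ψ x₁ hy hΨ v]
  show 𝓢.timeOrientation.IsFutureDirected (x := Ψ ((chartAt E4 x₁).symm y)) _ ↔ _
  rw [hp]

/-- **Future-directedness of a push-forward depends only on the germ of the map**: if `f = g` near
`y` then `df_y(v)` future-directed implies `dg_y(v)` future-directed (same differential,
`Filter.EventuallyEq.mfderiv_eq`, same base point `f y = g y`). [folklore] -/
theorem isFutureDirected_mfderiv_congr {N : Type*} [TopologicalSpace N] [ChartedSpace E4 N]
    {f g : N → 𝓢.carrier} {y : N} (h : f =ᶠ[𝓝 y] g) (v : E4)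
    (hf : 𝓢.timeOrientation.IsFutureDirected (mfderiv 𝓘(ℝ, E4) (𝓡 4) f y v)) :
    𝓢.timeOrientation.IsFutureDirected (mfderiv 𝓘(ℝ, E4) (𝓡 4) g y v) := by
  have h1 : mfderiv 𝓘(ℝ, E4) (𝓡 4) g y = mfderiv 𝓘(ℝ, E4) (𝓡 4) f y := h.symm.mfderiv_eq
  have h2 : g y = f y := h.eq_of_nhds.symm
  have key : ∀ (p : 𝓢.carrier), p = f y → ∀ w : E4,
      𝓢.timeOrientation.IsFutureDirected (x := f y) w → 𝓢.timeOrientation.IsFutureDirected (x := p) w := by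
    rintro p rfl w hw
    exact hw
  rw [h1]
  exact key (g y) h2 (mfderiv 𝓘(ℝ, E4) (𝓡 4) f y v) hf

/-! ## Curves: the lift of a straight chart line under a smooth chart map -/

/-- The straight chart line `s ↦ x₀ + s • v` of `E4` has derivative `v`. [folklore] -/
private theorem hasDerivAt_line (x₀ v : E4) (t : ℝ) :
    HasDerivAt (fun s : ℝ ↦ x₀ + s • v) v t := by
  simpa using ((hasDerivAt_id t).smul_const v).const_add x₀

/-- The velocity of the straight chart line (as a curve in the manifold `E4`) is `v`. [folklore] -/
private theorem velocity_line (x₀ v : E4) (t : ℝ) :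
    velocity 𝓘(ℝ, E4) (fun s : ℝ ↦ x₀ + s • v) t = v := by
  -- adapted from `velocity_vert` (ClusterCompletenessRecurrentlyFlatDispersesStubChartFuture)
  simp only [velocity]
  rw [mfderiv_eq_fderiv, ← toSpanSingleton_deriv, (hasDerivAt_line x₀ v t).deriv]
  exact one_smul ℝ _

/-- Chain rule for velocities: `(f ∘ γ)'(t) = df_{γ t}(γ' t)`. [folklore] -/
private theorem velocity_comp' {E' : Type*} [NormedAddCommGroup E'] [NormedSpace ℝ E']
    {H' : Type*} [TopologicalSpace H'] {I' : ModelWithCorners ℝ E' H'} {N : Type*}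
    [TopologicalSpace N] [ChartedSpace H' N]
    {E : Type*} [NormedAddCommGroup E] [NormedSpace ℝ E] {H : Type*} [TopologicalSpace H]
    {I : ModelWithCorners ℝ E H} {M : Type*} [TopologicalSpace M] [ChartedSpace H M]
    {f : N → M} {γ : ℝ → N} {t : ℝ} (hf : MDifferentiableAt I' I f (γ t))
    (hγ : MDifferentiableAt 𝓘(ℝ, ℝ) I' γ t) :
    velocity I (f ∘ γ) t = mfderiv I' I f (γ t) (velocity I' γ t) := by
  simp only [velocity]
  rw [mfderiv_comp t hf hγ]
  rfl

/-- **The lifted straight line and its velocity.** For a smooth chart map `Ψ : U₀ → 𝓢` on an open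
`U₀ ⊆ E4` and a curve `c : ℝ → U₀` whose underlying `E4`-curve is the straight line `s ↦ x₀ + s • v`,
the lift `Ψ ∘ c` is smooth and its velocity at `t` is `dΨ_{c t}(v)`. [folklore] -/
private theorem line_lift {U₀ : TopologicalSpace.Opens E4}
    {Ψ : U₀ → 𝓢.carrier} (hΨ : ContMDiff 𝓘(ℝ, E4) (𝓡 4) ∞ Ψ) (x₀ v : E4) {c : ℝ → U₀}
    (hc : ∀ s : ℝ, (c s : E4) = x₀ + s • v) :
    ContMDiff 𝓘(ℝ, ℝ) (𝓡 4) ∞ (Ψ ∘ c) ∧ ∀ t : ℝ, MDifferentiableAt 𝓘(ℝ, ℝ) (𝓡 4) (Ψ ∘ c) t ∧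
      velocity (𝓡 4) (Ψ ∘ c) t = mfderiv 𝓘(ℝ, E4) (𝓡 4) Ψ (c t) v := by
  -- adapted from `line_lift` of the S2 work file (stub_orientationAnchor)
  have hcv : Subtype.val ∘ c = (fun s : ℝ ↦ x₀ + s • v) := funext hc
  have hp_smooth : ContMDiff 𝓘(ℝ, ℝ) 𝓘(ℝ, E4) ∞ (fun s : ℝ ↦ x₀ + s • v) :=
    contMDiff_iff_contDiff.mpr (contDiff_const.add (contDiff_id.smul contDiff_const))
  have hc_smooth : ContMDiff 𝓘(ℝ, ℝ) 𝓘(ℝ, E4) ∞ c :=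
    (ContMDiff.subtypeVal_comp_iff U₀ c).mp (hcv ▸ hp_smooth)
  have hγ : ContMDiff 𝓘(ℝ, ℝ) (𝓡 4) ∞ (Ψ ∘ c) := hΨ.comp hc_smooth
  refine ⟨hγ, fun t ↦ ⟨hγ.mdifferentiableAt (by simp), ?_⟩⟩
  have hct : MDifferentiableAt 𝓘(ℝ, ℝ) 𝓘(ℝ, E4) c t := hc_smooth.mdifferentiableAt (by simp)
  have hΨt : MDifferentiableAt 𝓘(ℝ, E4) (𝓡 4) Ψ (c t) := hΨ.mdifferentiableAt (by simp)
  have hvc : velocity 𝓘(ℝ, E4) c t = v := by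
    have h1 : velocity 𝓘(ℝ, E4) (Subtype.val ∘ c) t =
        mfderiv 𝓘(ℝ, E4) 𝓘(ℝ, E4) (Subtype.val : U₀ → E4) (c t) (velocity 𝓘(ℝ, E4) c t) :=
      velocity_comp' (hasMFDerivAt_subtypeVal (c t)).mdifferentiableAt hct
    rw [mfderiv_subtypeVal, hcv, velocity_line] at h1
    exact h1.symm
  rw [velocity_comp' hΨt hct, hvc]

/-! ## Leg 2, abstractly: a coordinate segment with causal velocities, future-directed at its start -/

/-- **A coordinate segment with causal velocities, future-directed at its start, joins its
endpoints causally.** For `ψ : E4 → 𝓢` smooth on an open `O'` containing the segment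
`{y + θu | 0 ≤ θ ≤ ℓ}` (`ℓ > 0`), if `dψ_{y+θu}(u)` is causal along the segment and future-directed at
`θ = 0`, then it is future-directed along the whole (connected) segment (one sign,
`isFutureDirected_mfderiv_apply_of_isPreconnected`), so `θ ↦ ψ(y + θu)` is a future causal curve and
`ψ(y + ℓu) ∈ J⁺(ψ y)`. O'Neill 1983, Ch. 5, Lemma 5.26 ff.; Ch. 14, p. 402. [folklore] -/
theorem segment_mem_causalFuture {O' : Set E4} (hO' : IsOpen O')
    {ψ : E4 → 𝓢.carrier} (hψ : ContMDiffOn 𝓘(ℝ, E4) (𝓡 4) ∞ ψ O') (y u : E4) {ℓ : ℝ} (hℓ : 0 < ℓ)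
    (hsub : ∀ θ ∈ Icc (0 : ℝ) ℓ, y + θ • u ∈ O')
    (hc : ∀ θ ∈ Icc (0 : ℝ) ℓ, 𝓢.metric.IsCausal (mfderiv 𝓘(ℝ, E4) (𝓡 4) ψ (y + θ • u) u))
    (h0 : 𝓢.timeOrientation.IsFutureDirected (mfderiv 𝓘(ℝ, E4) (𝓡 4) ψ y u)) :
    ψ (y + ℓ • u) ∈ 𝓢.metric.causalFuture 𝓢.timeOrientation {ψ y} := by
  -- one sign along the (connected) segment
  set p : ℝ → E4 := fun θ ↦ y + θ • u with hp
  have hpc : Continuous p := by fun_prop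
  have hS : IsPreconnected (p '' Icc 0 ℓ) := isPreconnected_Icc.image p hpc.continuousOn
  have hSO : p '' Icc 0 ℓ ⊆ O' := by
    rintro _ ⟨θ, hθ, rfl⟩
    exact hsub θ hθ
  have hy0 : y ∈ p '' Icc 0 ℓ := ⟨0, ⟨le_rfl, hℓ.le⟩, by simp [hp]⟩
  have hfd := 𝓢.isFutureDirected_mfderiv_apply_of_isPreconnected hO' hψ hS hSO (fun _ ↦ u)
    continuousOn_const (by rintro _ ⟨θ, hθ, rfl⟩; exact hc θ hθ) hy0 h0
  -- the lifted segment is a future causal curve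
  have hcurve : 𝓢.metric.IsFutureCausalCurveOn 𝓢.timeOrientation (fun θ : ℝ ↦ ψ (y + θ • u))
      (Icc 0 ℓ) := by
    intro θ hθ
    have hd : MDifferentiableAt 𝓘(ℝ, E4) (𝓡 4) ψ (y + θ • u) :=
      (hψ.contMDiffAt (hO'.mem_nhds (hsub θ hθ))).mdifferentiableAt (by simp)
    obtain ⟨hmd, hvel⟩ := velocity_comp_affine 𝓢 ψ y u θ hd
    refine ⟨hmd, ?_⟩
    rw [hvel]
    exact hfd _ ⟨θ, hθ, rfl⟩
  refine Or.inr ⟨ψ y, rfl, fun θ : ℝ ↦ ψ (y + θ • u), 0, ℓ, hℓ, hcurve, ?_, rfl⟩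
  simp

/-- **Leg 2 through the inclusion chart.** The same for a chart map `Ψg : B.domain → 𝓢` smooth on the
piece `val ⁻¹' V` of an open `V ⊆ B.domain` containing the segment: read `Ψg` through the inclusion
chart (`Ψg ∘ (chartAt E4 x₁).symm`, identity differential). [folklore] -/
theorem leg_two_causal (B : ModelBackground) (Ψg : B.domain → 𝓢.carrier)
    {V : Set E4} (hVo : IsOpen V) (hVB : V ⊆ (B.domain : Set E4))
    (hG1 : ContMDiffOn 𝓘(ℝ, E4) (𝓡 4) ∞ Ψg (Subtype.val ⁻¹' V))
    (y u : E4) {ℓ : ℝ} (hℓ : 0 < ℓ) (hsub : ∀ θ ∈ Icc (0 : ℝ) ℓ, y + θ • u ∈ V)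
    (hc : ∀ θ ∈ Icc (0 : ℝ) ℓ, ∀ h : y + θ • u ∈ (B.domain : Set E4),
      𝓢.metric.IsCausal (mfderiv 𝓘(ℝ, E4) (𝓡 4) Ψg ⟨y + θ • u, h⟩ u))
    (hy : y ∈ (B.domain : Set E4)) (hyℓ : y + ℓ • u ∈ (B.domain : Set E4))
    (h0 : 𝓢.timeOrientation.IsFutureDirected (mfderiv 𝓘(ℝ, E4) (𝓡 4) Ψg ⟨y, hy⟩ u)) :
    Ψg ⟨y + ℓ • u, hyℓ⟩ ∈ 𝓢.metric.causalFuture 𝓢.timeOrientation {Ψg ⟨y, hy⟩} := by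
  set x₁ : B.domain := ⟨y, hy⟩ with hx₁
  set ψ : E4 → 𝓢.carrier := Ψg ∘ (chartAt E4 x₁).symm with hψ
  have hψs : ContMDiffOn 𝓘(ℝ, E4) (𝓡 4) ∞ ψ V :=
    𝓢.contMDiffOn_comp_chartAt_symm_of_contMDiffOn B Ψg x₁ hVB hG1
  have hmd : ∀ {z : E4} (hz : z ∈ V), MDifferentiableAt 𝓘(ℝ, E4) (𝓡 4) Ψg ⟨z, hVB hz⟩ :=
    fun hz ↦ 𝓢.mdifferentiableAt_of_contMDiffOn_preimage B Ψg hVo hG1 (hVB hz) hz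
  have hval : ∀ {z : E4} (hz : z ∈ (B.domain : Set E4)), ψ z = Ψg ⟨z, hz⟩ := fun hz ↦ by
    show Ψg ((chartAt E4 x₁).symm _) = _
    rw [chartAt_symm_eq B x₁ hz]
  have hy0 : y ∈ V := by simpa using hsub 0 ⟨le_rfl, hℓ.le⟩
  have key := segment_mem_causalFuture 𝓢 hVo hψs y u hℓ hsub
    (fun θ hθ ↦ (isCausal_comp_chartAt_symm_iff 𝓢 B Ψg x₁ (hVB (hsub θ hθ)) (hmd (hsub θ hθ)) u).2
      (hc θ hθ _))
    ((isFutureDirected_comp_chartAt_symm_iff 𝓢 B Ψg x₁ hy (hmd hy0) u).2 h0)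
  rwa [hval hyℓ, hval hy] at key

/-! ## Leg 1: the label's time axis through the collar point -/

/-- **Leg 1.** For a smooth chart map `Ψ` of a boosted Kerr background and a point `y` of its domain,
if along the `Λe₀`-line below `y` — at the points `x` with `t y − s₁ ≤ t x ≤ t y`, `r x = r y` — the
push-forward `dΨ(Λe₀)` is future-directed with `g(dΨ Λe₀, dΨ Λe₀) ≤ −9/10`, then the lift
`γ(s) = Ψ(y + (s − s₁)Λe₀)`, `0 ≤ s ≤ s₁`, is a future causal curve ending at `Ψ y`, through chart
points of times `t y − s₁ + s`, of arc length `≥ (9/10) s₁` (speed `√|g(γ',γ')| ≥ 9/10`), and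
`Ψ y ∈ J⁺(γ s)` for each of its points. O'Neill 1983, Ch. 5, Def. 5.11; Ch. 14, p. 402. [folklore] -/
theorem leg_one (Λ : lorentzGroup) (c : E4) (M a : ℝ)
    (Ψ : (boostedKerrBackground Λ c M a).domain → 𝓢.carrier)
    (hΨ : ContMDiff 𝓘(ℝ, E4) (𝓡 4) ∞ Ψ) (y : (boostedKerrBackground Λ c M a).domain) {s₁ : ℝ}
    (hfd : ∀ x : (boostedKerrBackground Λ c M a).domain,
      (boostedKerrBackground Λ c M a).time y.1 - s₁ ≤ (boostedKerrBackground Λ c M a).time x.1 →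
      (boostedKerrBackground Λ c M a).time x.1 ≤ (boostedKerrBackground Λ c M a).time y.1 →
      (boostedKerrBackground Λ c M a).radius x.1 = (boostedKerrBackground Λ c M a).radius y.1 →
      𝓢.timeOrientation.IsFutureDirected
          (mfderiv 𝓘(ℝ, E4) (𝓡 4) Ψ x ((Λ : E4 ≃L[ℝ] E4) (E4.basisVector 0))) ∧
        𝓢.metric.val (Ψ x) (mfderiv 𝓘(ℝ, E4) (𝓡 4) Ψ x ((Λ : E4 ≃L[ℝ] E4) (E4.basisVector 0)))
          (mfderiv 𝓘(ℝ, E4) (𝓡 4) Ψ x ((Λ : E4 ≃L[ℝ] E4) (E4.basisVector 0))) ≤ -(9 / 10)) :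
    ∃ γ : ℝ → 𝓢.carrier, 𝓢.metric.IsFutureCausalCurveOn 𝓢.timeOrientation γ (Icc 0 s₁) ∧
      γ s₁ = Ψ y ∧
      (∀ s ∈ Icc 0 s₁, ∃ x : (boostedKerrBackground Λ c M a).domain, γ s = Ψ x ∧
        (boostedKerrBackground Λ c M a).time x.1 = (boostedKerrBackground Λ c M a).time y.1 - s₁ + s) ∧
      ENNReal.ofReal (9 / 10 * s₁) ≤ 𝓢.metric.arcLength γ 0 s₁ ∧
      ∀ s ∈ Icc 0 s₁, Ψ y ∈ 𝓢.metric.causalFuture 𝓢.timeOrientation {γ s} := by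
  set v : E4 := (Λ : E4 ≃L[ℝ] E4) (E4.basisVector 0) with hv
  set x₀ : E4 := y.1 - s₁ • v with hx₀
  have hline : ∀ s : ℝ, x₀ + s • v = y.1 + (s - s₁) • v := fun s ↦ by
    rw [hx₀, sub_smul]; abel
  set cur : ℝ → (boostedKerrBackground Λ c M a).domain := fun s ↦
    ⟨x₀ + s • v, by rw [hline]; exact mem_domain_add_smul_axis Λ c M a y.2 _⟩ with hcur
  have hcurval : ∀ s : ℝ, (cur s : E4) = x₀ + s • v := fun s ↦ rfl
  have hcur₁ : cur s₁ = y := Subtype.ext (by rw [hcurval, hline, sub_self, zero_smul, add_zero])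
  have htime : ∀ s : ℝ, (boostedKerrBackground Λ c M a).time (cur s).1 =
      (boostedKerrBackground Λ c M a).time y.1 + (s - s₁) := fun s ↦ by
    rw [hcurval, hline]; exact time_add_smul_axis Λ c M a y.1 _
  have hrad : ∀ s : ℝ, (boostedKerrBackground Λ c M a).radius (cur s).1 =
      (boostedKerrBackground Λ c M a).radius y.1 := fun s ↦ by
    rw [hcurval, hline]; exact radius_add_smul_axis Λ c M a y.1 _
  obtain ⟨-, hvel⟩ := line_lift 𝓢 hΨ x₀ v (c := cur) hcurval
  have hprop : ∀ s ∈ Icc 0 s₁,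
      𝓢.timeOrientation.IsFutureDirected (velocity (𝓡 4) (Ψ ∘ cur) s) ∧
        𝓢.metric.val ((Ψ ∘ cur) s) (velocity (𝓡 4) (Ψ ∘ cur) s) (velocity (𝓡 4) (Ψ ∘ cur) s) ≤
          -(9 / 10) := by
    intro s hs
    rw [(hvel s).2]
    exact hfd (cur s) (by rw [htime]; linarith [hs.1]) (by rw [htime]; linarith [hs.2]) (hrad s)
  have hcurve : 𝓢.metric.IsFutureCausalCurveOn 𝓢.timeOrientation (Ψ ∘ cur) (Icc 0 s₁) :=
    fun s hs ↦ ⟨(hvel s).1, (hprop s hs).1⟩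
  have hγ₁ : (Ψ ∘ cur) s₁ = Ψ y := by
    show Ψ (cur s₁) = Ψ y
    rw [hcur₁]
  refine ⟨Ψ ∘ cur, hcurve, hγ₁, fun s _ ↦ ⟨cur s, rfl, by rw [htime]; ring⟩, ?_, fun s hs ↦ ?_⟩
  · -- length: speed `≥ 9/10` on `[0, s₁]`
    have hsp : ∀ s ∈ Icc 0 s₁, (9 / 10 : ℝ) ≤ 𝓢.metric.speed (Ψ ∘ cur) s := by
      intro s hs
      rw [PseudoRiemannianMetric.speed_def]
      refine Real.le_sqrt_of_sq_le ?_
      have h := (hprop s hs).2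
      rw [abs_of_nonpos (by linarith)]
      nlinarith
    calc ENNReal.ofReal (9 / 10 * s₁) = ∫⁻ _ in Icc (0 : ℝ) s₁, ENNReal.ofReal (9 / 10) := by
          rw [setLIntegral_const, Real.volume_Icc, sub_zero, ← ENNReal.ofReal_mul (by norm_num)]
      _ ≤ ∫⁻ s in Icc (0 : ℝ) s₁, ENNReal.ofReal (𝓢.metric.speed (Ψ ∘ cur) s) :=
          setLIntegral_mono' measurableSet_Icc fun s hs ↦ ENNReal.ofReal_le_ofReal (hsp s hs)
      _ = 𝓢.metric.arcLength (Ψ ∘ cur) 0 s₁ := rfl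
  · rcases eq_or_lt_of_le hs.2 with h | h
    · rw [h, hγ₁]
      exact LorentzianMetric.subset_causalFuture _ _ _ rfl
    · exact Or.inr ⟨(Ψ ∘ cur) s, rfl, Ψ ∘ cur, s, s₁, h, hcurve.mono (Icc_subset_Icc hs.1 le_rfl),
        rfl, hγ₁⟩

end Chart

/-! ## Leg 2: kinematics from the collar sphere outward to the escape point, under the wall -/

/-- **Sub-wall bookkeeping** (pure inequality): going back along leg 2 by `d = ℓ₂ − θ`, the radius
drops by at least `d q` with `q = κ rₙ ≥ 1/3`, the lab time changes by `d u⁰` with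
`|u⁰| ≤ (3/2)‖Λ‖`, and the wall drops by at most its slope `1/(10‖Λ‖²)` times that, `≤ (3/20) d`;
so `r ≤ W(x⁰)` propagates backwards from the escape point. [folklore] -/
theorem subwall_ineq {W : ℝ → ℝ} (hWm : Monotone W) {K : ℝ} (hK : 1 ≤ K)
    (hWl : ∀ s s', s ≤ s' → W s' ≤ W s + 1 / (10 * K ^ 2) * (s' - s))
    {rN ρ q d u0 sN : ℝ} (hd : 0 ≤ d) (hq : 1 / 3 ≤ q) (hρ : ρ ≤ rN - d * q)
    (hu : |u0| ≤ K * (3 / 2)) (hN : rN ≤ W sN) : ρ ≤ W (sN - d * u0) := by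
  have hdq : 0 ≤ d * q := mul_nonneg hd (by linarith)
  rcases le_or_gt (d * u0) 0 with h | h
  · have h1 : W sN ≤ W (sN - d * u0) := hWm (by linarith)
    linarith
  · have h1 := hWl (sN - d * u0) sN (by linarith)
    have h2 : d * u0 ≤ d * (K * (3 / 2)) := mul_le_mul_of_nonneg_left ((le_abs_self u0).trans hu) hd
    have hK0 : 0 < K := by linarith
    have h3 : 1 / (10 * K ^ 2) * (sN - (sN - d * u0)) ≤ d * (3 / 20) / K := by
      rw [sub_sub_cancel]
      calc 1 / (10 * K ^ 2) * (d * u0) ≤ 1 / (10 * K ^ 2) * (d * (K * (3 / 2))) :=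
            mul_le_mul_of_nonneg_left h2 (by positivity)
        _ = d * (3 / 20) / K := by field_simp; ring
    have h4 : d * (3 / 20) / K ≤ d * (3 / 20) := div_le_self (by positivity) hK
    nlinarith

/-- `r₊ ≤ 2M` for `M ≥ 0`. [folklore] -/
private theorem rPlus_le_two_mul {M : ℝ} (hM : 0 ≤ M) (a : ℝ) : Kerr.rPlus M a ≤ 2 * M := by
  -- adapted from the S4a work file (stub_subwallClosureOfNoEscape)
  unfold Kerr.rPlus
  have h : √(M ^ 2 - a ^ 2) ≤ M :=
    (Real.sqrt_le_sqrt (by nlinarith [sq_nonneg a])).trans_eq (Real.sqrt_sq hM)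
  linarith

/-- **Leg 2 kinematics** (boosted Kerr background `(Λ, c, M, a)`, `0 < M`, `|a| ≤ M`,
`100 M ≤ R₁ + ½`; wall `W` non-decreasing of slope `≤ 1/(10‖Λ‖²)`).  Let the escape point have rest
coordinates `(tₙ, ξ)`, `ρ = ‖ξ‖`, rest radius `rₙ = r(ξ) ≤ W(x⁰ₙ)`, and let `σ ∈ (0,1)` be the collar
scale, `r(σξ) = R₁ + ½`.  The lab segment `θ ↦ y₁ + θu`, `0 ≤ θ ≤ ℓ = 2ρ(1 − σ)`, with
`y₁ = Λ(tₙ − ℓ, σξ) + c`, `u = Λ(1, ξ/(2ρ))` (rest speed `½`) ends at the escape point, has rest times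
`tₙ − ℓ + θ`, rest radii in `[R₁ + ½, W(x⁰)]` (scaling of the Kerr–Schild radius along rays,
`radius_smul_le`, and the sub-wall bookkeeping `subwall_ineq`), stays in the domain, and
`ℓ ≤ 3rₙ`, `ρ ≤ (3/2) rₙ`. Visser arXiv:0706.0622, (35). [folklore] -/
theorem leg_two_kinematics (Λ : lorentzGroup) (c : E4) {M a R₁ : ℝ} (hM : 0 < M) (haM : |a| ≤ M)
    (h100 : 100 * M ≤ R₁ + 1 / 2) {W : ℝ → ℝ} (hWm : Monotone W)
    (hWl : ∀ s s', s ≤ s' →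
      W s' ≤ W s + 1 / (10 * ‖((Λ : E4 ≃L[ℝ] E4) : E4 →L[ℝ] E4)‖ ^ 2) * (s' - s))
    {tN σ : ℝ} {ξ : E3} (hσ0 : 0 < σ) (hσ1 : σ < 1)
    (hcollar : Kerr.radius a (E4.ofTimeSpace 0 (σ • ξ)) = R₁ + 1 / 2)
    (hxW : Kerr.radius a (E4.ofTimeSpace 0 ξ) ≤ W (((Λ : E4 ≃L[ℝ] E4) (E4.ofTimeSpace tN ξ) + c) 0))
    {ℓ : ℝ} {y₁ u : E4} (hℓ : ℓ = 2 * ‖ξ‖ * (1 - σ))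
    (hy₁ : y₁ = (Λ : E4 ≃L[ℝ] E4) (E4.ofTimeSpace (tN - ℓ) (σ • ξ)) + c)
    (hu : u = (Λ : E4 ≃L[ℝ] E4) (E4.ofTimeSpace 1 ((1 / (2 * ‖ξ‖)) • ξ))) :
    0 < ℓ ∧ ‖(1 / (2 * ‖ξ‖)) • ξ‖ = 1 / 2 ∧
    y₁ + ℓ • u = (Λ : E4 ≃L[ℝ] E4) (E4.ofTimeSpace tN ξ) + c ∧
    (boostedKerrBackground Λ c M a).time y₁ = tN - ℓ ∧
    (boostedKerrBackground Λ c M a).radius y₁ = R₁ + 1 / 2 ∧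
    ℓ ≤ 3 * Kerr.radius a (E4.ofTimeSpace 0 ξ) ∧ ‖ξ‖ ≤ 3 / 2 * Kerr.radius a (E4.ofTimeSpace 0 ξ) ∧
    ∀ θ ∈ Icc 0 ℓ, y₁ + θ • u ∈ (boostedKerrBackground Λ c M a).domain ∧
      (boostedKerrBackground Λ c M a).time (y₁ + θ • u) = tN - ℓ + θ ∧
      R₁ + 1 / 2 ≤ (boostedKerrBackground Λ c M a).radius (y₁ + θ • u) ∧
      (boostedKerrBackground Λ c M a).radius (y₁ + θ • u) ≤ W ((y₁ + θ • u) 0) := by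
  set L₀ := ‖((Λ : E4 ≃L[ℝ] E4) : E4 →L[ℝ] E4)‖ with hL₀
  have hL₀1 : 1 ≤ L₀ := one_le_norm_lorentz Λ
  set ρ := ‖ξ‖ with hρ
  set κ : ℝ := 1 / (2 * ρ) with hκ
  set rN := Kerr.radius a (E4.ofTimeSpace 0 ξ) with hrN
  set Rc := R₁ + 1 / 2 with hRc
  -- positivity of the scales
  have hRc : 0 < Rc := by linarith
  have hσρ : Rc ≤ σ * ρ := by
    have h := Kerr.radius_ofTimeSpace_le_norm a 0 (σ • ξ)
    rwa [hcollar, norm_smul, Real.norm_eq_abs, abs_of_pos hσ0] at h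
  have hρσ : σ * ρ ≤ ρ := by nlinarith [mul_nonneg (norm_nonneg ξ) (sub_nonneg.2 hσ1.le)]
  have hRcρ : Rc ≤ ρ := hσρ.trans hρσ
  have hρpos : 0 < ρ := lt_of_mul_lt_mul_left (by linarith : σ * 0 < σ * ρ) hσ0.le
  have hρne : ρ ≠ 0 := hρpos.ne'
  have hκpos : 0 < κ := by positivity
  have hκρ : κ * ρ = 1 / 2 := by rw [hκ]; field_simp
  have hκξ : ‖κ • ξ‖ = 1 / 2 := by rw [norm_smul, Real.norm_eq_abs, abs_of_pos hκpos, ← hρ, hκρ]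
  have hℓpos : 0 < ℓ := by rw [hℓ]; exact mul_pos (by positivity) (by linarith)
  have hκℓ : κ * ℓ = 1 - σ := by rw [hκ, hℓ]; field_simp
  -- `a² ≤ (Rc/100)²`
  have ha : a ^ 2 ≤ (Rc / 100) ^ 2 := by
    have h1 : |a| ≤ Rc / 100 := by linarith
    calc a ^ 2 = |a| ^ 2 := (sq_abs a).symm
      _ ≤ (Rc / 100) ^ 2 := pow_le_pow_left₀ (abs_nonneg a) h1 2
  have hRc2 : Rc ^ 2 ≤ ρ ^ 2 := pow_le_pow_left₀ hRc.le hRcρ 2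
  -- `rN ≥ 2ρ/3 > 0`
  have hrN0 : 0 ≤ rN := Kerr.radius_nonneg a _
  have hρrN : ρ ≤ 3 / 2 * rN := by
    have h1 := Kerr.spatialNorm_sq_sub_sq_le_radius_sq a (E4.ofTimeSpace 0 ξ)
    rw [E4.spatialNorm_ofTimeSpace] at h1
    have h2 : (2 * ρ / 3) ^ 2 ≤ rN ^ 2 := by nlinarith
    have h3 := (abs_le_of_sq_le_sq' h2 hrN0).2
    linarith
  have hrNpos : 0 < rN := by linarith
  have hℓ3 : ℓ ≤ 3 * rN := by rw [hℓ]; nlinarith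
  -- the affine identity, the endpoint, the rest frame of the segment points
  have haff : ∀ θ : ℝ, y₁ + θ • u =
      (Λ : E4 ≃L[ℝ] E4) (E4.ofTimeSpace (tN - ℓ + θ) ((σ + κ * θ) • ξ)) + c := by
    intro θ
    rw [ofTimeSpace_affine, map_add, map_smul, hy₁, hu]
    abel
  have hend : y₁ + ℓ • u = (Λ : E4 ≃L[ℝ] E4) (E4.ofTimeSpace tN ξ) + c := by
    have h1 : tN - ℓ + ℓ = tN := by ring
    have h2 : (σ + (1 - σ)) • ξ = ξ := by rw [show σ + (1 - σ) = (1 : ℝ) by ring, one_smul]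
    rw [haff, hκℓ, h1, h2]
  have hrest : ∀ θ : ℝ, poincareInv Λ c (y₁ + θ • u) = E4.ofTimeSpace (tN - ℓ + θ) ((σ + κ * θ) • ξ) := by
    intro θ; rw [haff, poincareInv_apply_add]
  have htime : ∀ θ : ℝ, (boostedKerrBackground Λ c M a).time (y₁ + θ • u) = tN - ℓ + θ := by
    intro θ
    show poincareInv Λ c (y₁ + θ • u) 0 = _
    rw [hrest, E4.ofTimeSpace_apply_zero]
  have hradius : ∀ θ : ℝ, (boostedKerrBackground Λ c M a).radius (y₁ + θ • u) =
      Kerr.radius a (E4.ofTimeSpace 0 ((σ + κ * θ) • ξ)) := by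
    intro θ
    show Kerr.radius a (poincareInv Λ c (y₁ + θ • u)) = _
    rw [hrest, Kerr.radius_ofTimeSpace]
  -- radius bounds along the segment
  have hseg : ∀ θ ∈ Icc 0 ℓ, Rc ≤ Kerr.radius a (E4.ofTimeSpace 0 ((σ + κ * θ) • ξ)) ∧
      Kerr.radius a (E4.ofTimeSpace 0 ((σ + κ * θ) • ξ)) ≤ rN - (ℓ - θ) * (κ * rN) := by
    intro θ hθ
    set lam := σ + κ * θ with hlam
    have hκθ : 0 ≤ κ * θ := mul_nonneg hκpos.le hθ.1
    have hlamσ : σ ≤ lam := by linarith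
    have hlam0 : 0 < lam := by linarith
    have hlam1 : lam ≤ 1 := by
      have := mul_le_mul_of_nonneg_left hθ.2 hκpos.le
      linarith
    set rl := Kerr.radius a (E4.ofTimeSpace 0 (lam • ξ)) with hrl
    have hrl0 : 0 ≤ rl := Kerr.radius_nonneg a _
    have hrl2 : (lam * ρ) ^ 2 - a ^ 2 ≤ rl ^ 2 := by
      have h := Kerr.spatialNorm_sq_sub_sq_le_radius_sq a (E4.ofTimeSpace 0 (lam • ξ))
      rwa [E4.spatialNorm_ofTimeSpace, norm_smul, Real.norm_eq_abs, abs_of_pos hlam0] at h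
    have hlamρ : Rc ≤ lam * ρ := hσρ.trans (mul_le_mul_of_nonneg_right hlamσ hρpos.le)
    have hrlpos : 0 < rl := by
      have h0 : Rc ^ 2 ≤ (lam * ρ) ^ 2 := pow_le_pow_left₀ hRc.le hlamρ 2
      have h1 : 0 < (lam * ρ) ^ 2 - a ^ 2 := by nlinarith [pow_pos hRc 2]
      have h2 : 0 < rl ^ 2 := by linarith
      rcases hrl0.eq_or_lt with h | h
      · rw [← h] at h2; norm_num at h2
      · exact h
    -- lower bound via scaling by `σ / lam`
    have hlow : Rc ≤ rl := by
      have h := radius_smul_le a (lam • ξ) (lam := σ / lam) (div_pos hσ0 hlam0)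
        (div_le_one_of_le₀ hlamσ hlam0.le) hrlpos
      rw [smul_smul, div_mul_cancel₀ σ hlam0.ne', hcollar] at h
      have h2 : σ / lam * rl ≤ rl := mul_le_of_le_one_left hrlpos.le (div_le_one_of_le₀ hlamσ hlam0.le)
      linarith
    -- upper bound via scaling by `lam`
    have hup : rl ≤ lam * rN := radius_smul_le a ξ hlam0 hlam1 hrNpos
    refine ⟨hlow, ?_⟩
    have : lam * rN = rN - (ℓ - θ) * (κ * rN) := by
      rw [hlam]; linear_combination rN * hκℓ
    linarith
  -- lab time along the segment and the slope bookkeeping constants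
  have hlab : ∀ θ : ℝ, (y₁ + θ • u) 0 =
      ((Λ : E4 ≃L[ℝ] E4) (E4.ofTimeSpace tN ξ) + c) 0 - (ℓ - θ) * u 0 := by
    intro θ
    rw [← hend]
    simp only [PiLp.add_apply, PiLp.smul_apply, smul_eq_mul]
    ring
  have hu0 : |u 0| ≤ L₀ * (3 / 2) := by
    have h1 : |u 0| ≤ ‖u‖ := by
      have := PiLp.norm_apply_le u 0
      rwa [Real.norm_eq_abs] at this
    have h2 : ‖u‖ ≤ L₀ * ‖E4.ofTimeSpace 1 (κ • ξ)‖ := by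
      rw [hu]; exact ((Λ : E4 ≃L[ℝ] E4) : E4 →L[ℝ] E4).le_opNorm _
    have h3 : ‖E4.ofTimeSpace 1 (κ • ξ)‖ ≤ 3 / 2 := by
      have := norm_ofTimeSpace_one_le (κ • ξ)
      rw [hκξ] at this
      linarith
    have h4 : L₀ * ‖E4.ofTimeSpace 1 (κ • ξ)‖ ≤ L₀ * (3 / 2) := mul_le_mul_of_nonneg_left h3 (by linarith)
    linarith
  have hq : 1 / 3 ≤ κ * rN := by
    rw [hκ, div_mul_eq_mul_div, one_mul, le_div_iff₀ (by positivity)]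
    linarith
  -- assemble
  refine ⟨hℓpos, hκξ, hend, ?_, ?_, hℓ3, hρrN, fun θ hθ ↦ ?_⟩
  · have := htime 0
    simp only [zero_smul, add_zero] at this
    exact this
  · have := hradius 0
    simp only [zero_smul, add_zero, mul_zero] at this
    rw [hcollar] at this
    exact this
  · obtain ⟨hlow, hup⟩ := hseg θ hθ
    have hr := hradius θ
    refine ⟨?_, htime θ, hr ▸ hlow, ?_⟩
    · show poincareInv Λ c (y₁ + θ • u) ∈ Kerr.exterior M a
      rw [hrest, Kerr.mem_exterior, Kerr.radius_ofTimeSpace]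
      refine max_lt ?_ ?_
      · have : Kerr.rPlus M a ≤ 2 * M := rPlus_le_two_mul hM.le a
        linarith
      · linarith
    · rw [hr, hlab θ]
      exact subwall_ineq hWm hL₀1 hWl (sub_nonneg.2 hθ.2) hq hup hu0 hxW

/-- The Kerr–Schild radius vanishes on the time axis: `r(τ, 0) = 0`. Visser arXiv:0706.0622, (35).
[folklore] -/
private theorem radius_ofTimeSpace_zero_right (a τ : ℝ) : Kerr.radius a (E4.ofTimeSpace τ 0) = 0 := by
  -- adapted from `radius_ofTimeSpace_zero_right` (Theorems/StarvedNecksFutureOrientedOfSeamedStubRay)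
  have h := Kerr.radius_ofTimeSpace_le_norm a τ (0 : E3)
  rw [norm_zero] at h
  exact le_antisymm h (Kerr.radius_nonneg a _)

/-- **The collar scale on a rest-frame ray**: if `r(ξ) ≥ R₁ + 1 > R₁ + ½ > 0` there is `σ ∈ (0, 1)`
with `r(σ ξ) = R₁ + ½` (the radius vanishes at the origin and is continuous along the ray;
intermediate value theorem). O'Neill 1995, Ch. 2, §2.1. [folklore] -/
theorem exists_collar_scale (a : ℝ) (ξ : E3) {R₁ : ℝ} (hR₁ : 0 < R₁ + 1 / 2)
    (hξ : R₁ + 1 ≤ Kerr.radius a (E4.ofTimeSpace 0 ξ)) :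
    ∃ σ : ℝ, 0 < σ ∧ σ < 1 ∧ Kerr.radius a (E4.ofTimeSpace 0 (σ • ξ)) = R₁ + 1 / 2 := by
  have hfc : Continuous fun s : ℝ ↦ Kerr.radius a (E4.ofTimeSpace 0 (s • ξ)) :=
    (Kerr.continuous_radius a).comp ((E4.continuous_ofTimeSpace 0).comp (continuous_id.smul continuous_const))
  have hf0 : Kerr.radius a (E4.ofTimeSpace 0 ((0 : ℝ) • ξ)) = 0 := by
    rw [zero_smul]
    exact radius_ofTimeSpace_zero_right a 0
  have hf1 : Kerr.radius a (E4.ofTimeSpace 0 ((1 : ℝ) • ξ)) = Kerr.radius a (E4.ofTimeSpace 0 ξ) := by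
    rw [one_smul]
  obtain ⟨σ, hσ, hfσ⟩ : ∃ σ ∈ Icc (0 : ℝ) 1, Kerr.radius a (E4.ofTimeSpace 0 (σ • ξ)) = R₁ + 1 / 2 :=
    intermediate_value_Icc zero_le_one hfc.continuousOn ⟨by rw [hf0]; linarith, by rw [hf1]; linarith⟩
  refine ⟨σ, ?_, ?_, hfσ⟩
  · rcases hσ.1.eq_or_lt with h | h
    · rw [← h, hf0] at hfσ; linarith
    · exact h
  · rcases hσ.2.eq_or_lt' with h | h
    · rw [← h, hf1] at hfσ; linarith
    · exact h


end Literature.Geometry.Lorentzian.BoostedKerrLegs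

end
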